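import Summits.ValiantsHypothesis.ValiantsHypothesis.Theorems.TwoProducts.RankThreeAffineToricWronskianCorner

/-!
# Toric Wronskians of monomials, part 10: LOCALISATION of the edge count to the cones of the vertices of the carrier (LV-3a)

After the no-merge chapter (✓ W4a/b/c: p721689, p722796, p723164, p723324 — outside merges every edge direction of a toric Wronskian is a pair direction
of `supp u`), the open part of (TW-flag, poly) sits at the RESONANT VERTICES of `Newt u` (val-idea-crit-8 g6, merge memo rev C (C1) / VERDICT #124).
THIS FILE types the elementary localisation in the chart language of ✓ `Eset`/`Xc`/`dir` — Newton-polygon bookkeeping, for ANY polynomial `F` against ANY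
carrier `u` (normalised to `u − u(0)`, whose support is `S1 u`):
§1 chart geometry: ★ `isUniqueTop_dir_of_between` («P unique top at μ₁ and μ₃ ⇒ at every μ₂ between»: the weight gap is affine in μ), ★
`exists_ball_isUniqueTop` (a unique top of `u` persists on a neighbourhood: finitely many strict affine inequalities, explicit margin), `exists_sample_notMem`
(an open interval avoids a finite set), `IsUniqueTop.unique`.
§2 ★ `coneTops σ u v F` := the support points of `F` that are its unique top at some non-exceptional `μ ∉ Xc σ u` where `v` is the unique top of `u − u(0)`
(«the distinct tops of F over the open cone of the vertex v», a data def with parameters); ★★ `card_ties_le_coneTops_sub_one`: the TIES of `F` inside the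
cone of `v` (off `Xc σ u`) number `≤ |coneTops| − 1` — sample a non-exceptional direction just above each tie (below the next one) and one below the smallest;
the sampled tops are pairwise distinct (a recurring top would by convexity be the unique top AT an intermediate tie), so `r` ties force `r + 1` tops.
§3 ★ `card_Eset_le_Xc_add_sum` (every chart value is in `Xc σ u` or has a unique top `v ∈ S1 u` of `u − u(0)`) and ★★ `card_Eset_le_localised`:
`|Eset σ F| ≤ |Xc σ u| + Σ_{v ∈ S1 u} (|coneTops σ u v F| − 1)` for every `F` and every non-constant `u`.
§4 for the toric Wronskian `W_{J(·,u)}(X^e)`: ★ `coneTops_toricW_subset_corner` — at a NON-resonant vertex (`det(e_i,v)` pairwise distinct) the cone tops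
reduce to the corner `Σ(e_i + i•v)` (✓ `toricW_isUniqueTop_corner`, `J(·,u) = J(·,u − u(0))`), so such `v` contributes `0` (`card_coneTops_toricW_sub_one_eq_zero`).
The sequel `…ToricWronskianConeBound` (LV-3b) bounds the number of RESONANT unique-top vertices by `K(K−1)` and types the one-vertex hypothesis shape
`ConeTopBound R` with its funnels to ✓ `TWFlagBound`, the body of `OLMLaw`, and the body of `OLMUniformT`.
HONEST LABEL: bookkeeping / typed localisation on the OPEN rung 3-AFF (side ladder, crux `stmt-ValiantsHypothesis-5906` `TwoProducts`); (TW-flag, poly) AT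
MERGES, `OLMLaw`, `RankThreeAffineLaw(Exp)`, `TwoProducts`, PCB, `ResidualLawV25` UNMOVED; 0 summit distance; VP ≠ VNP is NOT proved; no summit statement is
proved here.  `--supports stmt-ValiantsHypothesis-5906 --as helper` (val-port-4 g6; critic of record val-idea-crit-8 g6).  One new data def with parameters
(`coneTops`); no Prop-defs, no instances, no notation, no named facts. [folklore]
-/

noncomputable section
set_option linter.dupNamespace false

namespace Summit.ValiantsHypothesis.ValiantsHypothesis.Theorems.TwoProducts.RankTwoJacobian

open scoped BigOperators
open MvPolynomial
open Literature.LinearAlgebra.Matrix (wronskianMatrix wronskian wronskianMatrix_apply wronskian_def)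

section TowerKernel
open scoped Classical

/-! ### §1 Chart geometry: «unique top» is order-convex and open in the chart value `μ` -/

/-- ★ CONVEXITY: if `P` is the unique top of `F` in the chart directions `μ₁ ≤ μ₃`, then also at every `μ₂` between (the weight gap `wt P − wt s` is
affine in `μ`). [folklore] -/
theorem isUniqueTop_dir_of_between {σ : ℝ} {F : Poly2} {P : Expo} {μ₁ μ₂ μ₃ : ℝ} (h12 : μ₁ ≤ μ₂) (h23 : μ₂ ≤ μ₃)
    (h1 : IsUniqueTop (dir σ μ₁) F P) (h3 : IsUniqueTop (dir σ μ₃) F P) : IsUniqueTop (dir σ μ₂) F P := by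
  refine ⟨h1.1, fun s hs hsP => ?_⟩
  have a := h1.2 s hs hsP
  have b := h3.2 s hs hsP
  rw [wt_dir, wt_dir] at a b ⊢
  by_cases hc : ((s 0 : ℕ) : ℝ) ≤ (P 0 : ℕ)
  · nlinarith
  · nlinarith

/-- ★ OPENNESS: a unique top of `u` at the chart value `μ` stays the unique top on a neighbourhood of `μ` (finitely many strict affine inequalities). [folklore] -/
theorem exists_ball_isUniqueTop {σ : ℝ} {u : Poly2} {v : Expo} {μ : ℝ} (h : IsUniqueTop (dir σ μ) u v) :
    ∃ ε : ℝ, 0 < ε ∧ ∀ μ' : ℝ, |μ' - μ| < ε → IsUniqueTop (dir σ μ') u v := by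
  set B : ℝ := ((v 0 : ℕ) : ℝ) + ∑ s ∈ u.support, ((s 0 : ℕ) : ℝ) with hB
  have hB0 : 0 ≤ B := by rw [hB]; positivity
  have hBs : ∀ s ∈ u.support, |((v 0 : ℕ) : ℝ) - (s 0 : ℕ)| ≤ B := by
    intro s hs
    have h1 : ((s 0 : ℕ) : ℝ) ≤ ∑ s ∈ u.support, ((s 0 : ℕ) : ℝ) :=
      Finset.single_le_sum (f := fun s : Expo => ((s 0 : ℕ) : ℝ)) (fun _ _ => by positivity) hs
    have h2 : (0 : ℝ) ≤ (s 0 : ℕ) := Nat.cast_nonneg _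
    have h3 : (0 : ℝ) ≤ (v 0 : ℕ) := Nat.cast_nonneg _
    rw [abs_le]; constructor <;> linarith
  by_cases hne : (u.support.erase v).Nonempty
  · obtain ⟨s₀, hs₀, hmin⟩ := Finset.exists_min_image (u.support.erase v) (fun s => wt (dir σ μ) v - wt (dir σ μ) s) hne
    set m : ℝ := wt (dir σ μ) v - wt (dir σ μ) s₀ with hm
    have hm0 : 0 < m := by
      have := h.2 s₀ (Finset.mem_of_mem_erase hs₀) (Finset.ne_of_mem_erase hs₀); rw [hm]; linarith
    refine ⟨m / (B + 1), div_pos hm0 (by linarith), fun μ' hμ' => ⟨h.1, fun s hs hsv => ?_⟩⟩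
    have hgap : m ≤ wt (dir σ μ) v - wt (dir σ μ) s := hmin s (Finset.mem_erase.mpr ⟨hsv, hs⟩)
    have hb := hBs s hs
    have hshift : wt (dir σ μ') v - wt (dir σ μ') s = (wt (dir σ μ) v - wt (dir σ μ) s) + (μ' - μ) * (((v 0 : ℕ) : ℝ) - (s 0 : ℕ)) := by
      rw [wt_dir, wt_dir, wt_dir, wt_dir]; ring
    have hdg : -(|μ' - μ| * B) ≤ (μ' - μ) * (((v 0 : ℕ) : ℝ) - (s 0 : ℕ)) := by
      have h1 := neg_abs_le ((μ' - μ) * (((v 0 : ℕ) : ℝ) - (s 0 : ℕ)))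
      rw [abs_mul] at h1
      nlinarith [abs_nonneg (μ' - μ)]
    have hε : |μ' - μ| * B ≤ m / (B + 1) * B := mul_le_mul_of_nonneg_right (le_of_lt hμ') hB0
    have hlt : m / (B + 1) * B < m := by
      rw [div_mul_eq_mul_div, div_lt_iff₀ (by linarith)]; nlinarith
    linarith
  · refine ⟨1, one_pos, fun μ' _ => ⟨h.1, fun s hs hsv => absurd (Finset.mem_erase.mpr ⟨hsv, hs⟩ : s ∈ u.support.erase v) fun hh => hne ⟨s, hh⟩⟩⟩

/-- an open real interval avoids any finite set. [folklore] -/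
theorem exists_sample_notMem (E : Finset ℝ) {a b : ℝ} (hab : a < b) : ∃ x : ℝ, a < x ∧ x < b ∧ x ∉ E := by
  obtain ⟨x, hx, hxE⟩ := (Set.Ioo_infinite hab).exists_notMem_finset E
  exact ⟨x, hx.1, hx.2, hxE⟩

/-- two unique tops in one direction coincide. [folklore] -/
theorem IsUniqueTop.unique {ν : Fin 2 → ℝ} {F : Poly2} {P Q : Expo} (hP : IsUniqueTop ν F P) (hQ : IsUniqueTop ν F Q) : P = Q :=
  utop_unique ((isUniqueTop_iff _ _ _).mp hP) ((isUniqueTop_iff _ _ _).mp hQ)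

/-! ### §2 The tops of `F` over the cone of a vertex, and the tie count -/

/-- the CONE TOPS of `F` at the vertex `v` of the (normalised) carrier `u`: the support points of `F` that are its unique top in some non-exceptional chart
direction `μ ∉ Xc σ u` at which `v` is the unique top of `u − u(0)` — i.e. the distinct tops of `F` as the direction sweeps the open cone of `v`. [folklore] -/
def coneTops (σ : ℝ) (u : Poly2) (v : Expo) (F : Poly2) : Finset Expo :=
  F.support.filter fun P => ∃ μ : ℝ, μ ∉ Xc σ u ∧ IsUniqueTop (dir σ μ) (u - C (coeff 0 u)) v ∧ IsUniqueTop (dir σ μ) F P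

/-- ★★ **TIES ≤ TOPS − 1:** the edge directions (ties) of `F` inside the cone of `v` (off `Xc σ u`) number at most `|coneTops| − 1` — between two
consecutive ties and beyond the extreme ones the top is unique and constant, these tops are pairwise distinct (a top recurring across a tie would, by
convexity, be the unique top AT the tie), so `r` ties need `r + 1` tops. -/
theorem card_ties_le_coneTops_sub_one {σ : ℝ} (hσ : σ = 1 ∨ σ = -1) (u : Poly2) (v : Expo) (F : Poly2) :
    ((Eset σ F).filter fun μ => μ ∉ Xc σ u ∧ IsUniqueTop (dir σ μ) (u - C (coeff 0 u)) v).card ≤ (coneTops σ u v F).card - 1 := by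
  set u' : Poly2 := u - C (coeff 0 u) with hu'
  set S : Finset ℝ := (Eset σ F).filter fun μ => μ ∉ Xc σ u ∧ IsUniqueTop (dir σ μ) u' v with hS
  set E : Finset ℝ := Eset σ F ∪ Xc σ u with hE
  rcases S.eq_empty_or_nonempty with h0 | hSne
  · rw [h0, Finset.card_empty]; exact Nat.zero_le _
  -- `F ≠ 0`
  have hF0 : F ≠ 0 := by
    obtain ⟨t, ht⟩ := hSne
    obtain ⟨p, hp, -⟩ := (mem_Eset hσ).mp (Finset.mem_filter.mp ht).1
    intro h; rw [h, support_zero] at hp; exact absurd hp (Finset.notMem_empty _)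
  -- a unique top of `F` at a non-exceptional direction
  have htop : ∀ x : ℝ, x ∉ E → ∃ P, IsUniqueTop (dir σ x) F P := fun x hx =>
    exists_isUniqueTop_of_not_isEdgeDir hF0 fun h => hx (Finset.mem_union_left _ ((mem_Eset hσ).mpr h))
  -- ties are not unique-top directions
  have htie : ∀ t ∈ S, ∀ P, ¬ IsUniqueTop (dir σ t) F P := fun t ht P hP =>
    not_tie_of_utop ((isUniqueTop_iff _ _ _).mp hP) ((isEdgeDir_iff_tie _ _).mp ((mem_Eset hσ).mp (Finset.mem_filter.mp ht).1))
  -- for each tie, a top sampled just above it (below the next tie)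
  have hex : ∀ t ∈ S, ∃ P : Expo, P ∈ coneTops σ u v F ∧
      ∃ x : ℝ, t < x ∧ (∀ t' ∈ S, t < t' → x < t') ∧ IsUniqueTop (dir σ x) F P := by
    intro t ht
    obtain ⟨-, htX, htv⟩ := Finset.mem_filter.mp ht
    obtain ⟨ε, hε, hball⟩ := exists_ball_isUniqueTop htv
    -- the upper end of the sampling window
    have hb : ∃ b : ℝ, t < b ∧ b ≤ t + ε ∧ ∀ t' ∈ S, t < t' → b ≤ t' := by
      by_cases hn : (S.filter fun t' => t < t').Nonempty
      · refine ⟨min (t + ε) ((S.filter fun t' => t < t').min' hn), ?_, min_le_left _ _, fun t' ht' htt' => ?_⟩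
        · refine lt_min (by linarith) ?_
          have hm := Finset.min'_mem _ hn
          exact (Finset.mem_filter.mp hm).2
        · exact (min_le_right _ _).trans (Finset.min'_le _ _ (Finset.mem_filter.mpr ⟨ht', htt'⟩))
      · exact ⟨t + ε, by linarith, le_rfl, fun t' ht' htt' => absurd ⟨t', Finset.mem_filter.mpr ⟨ht', htt'⟩⟩ hn⟩
    obtain ⟨b, htb, hbε, hbS⟩ := hb
    obtain ⟨x, htx, hxb, hxE⟩ := exists_sample_notMem E htb
    obtain ⟨P, hP⟩ := htop x hxE
    have hxX : x ∉ Xc σ u := fun h => hxE (Finset.mem_union_right _ h)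
    have hxv : IsUniqueTop (dir σ x) u' v := hball x (by rw [abs_lt]; constructor <;> linarith)
    exact ⟨P, Finset.mem_filter.mpr ⟨hP.1, x, hxX, hxv, hP⟩, x, htx, fun t' ht' htt' => lt_of_lt_of_le hxb (hbS t' ht' htt'), hP⟩
  choose! Φ hΦmem hΦ using hex
  -- injective on the ties
  have hinj : Set.InjOn Φ ↑S := by
    intro t ht t' ht' heq
    by_contra hne
    rcases lt_or_gt_of_ne hne with hlt | hlt
    · obtain ⟨x, htx, hxS, hxP⟩ := hΦ t ht
      obtain ⟨x', ht'x', -, hx'P⟩ := hΦ t' ht'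
      rw [heq] at hxP
      exact htie t' ht' _ (isUniqueTop_dir_of_between (le_of_lt (hxS t' ht' hlt)) (le_of_lt ht'x') hxP hx'P)
    · obtain ⟨x, htx, hxS, hxP⟩ := hΦ t' ht'
      obtain ⟨x', htx', -, hx'P⟩ := hΦ t ht
      rw [← heq] at hxP
      exact htie t ht _ (isUniqueTop_dir_of_between (le_of_lt (hxS t ht hlt)) (le_of_lt htx') hxP hx'P)
  -- one more top, sampled below the smallest tie
  set t₁ : ℝ := S.min' hSne with ht₁
  have ht₁S : t₁ ∈ S := Finset.min'_mem _ _
  obtain ⟨-, -, ht₁v⟩ := Finset.mem_filter.mp ht₁S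
  obtain ⟨ε, hε, hball⟩ := exists_ball_isUniqueTop ht₁v
  obtain ⟨x₀, hx₀a, hx₀b, hx₀E⟩ := exists_sample_notMem E (show t₁ - ε < t₁ by linarith)
  obtain ⟨P₀, hP₀⟩ := htop x₀ hx₀E
  have hP₀mem : P₀ ∈ coneTops σ u v F :=
    Finset.mem_filter.mpr ⟨hP₀.1, x₀, fun h => hx₀E (Finset.mem_union_right _ h),
      hball x₀ (by rw [abs_lt]; constructor <;> linarith), hP₀⟩
  have hP₀ne : ∀ t ∈ S, Φ t ≠ P₀ := by
    intro t ht heq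
    obtain ⟨x, htx, -, hxP⟩ := hΦ t ht
    rw [heq] at hxP
    have ht₁t : t₁ ≤ t := Finset.min'_le _ _ ht
    exact htie t₁ ht₁S _ (isUniqueTop_dir_of_between (le_of_lt hx₀b) (by linarith) hP₀ hxP)
  -- count
  calc S.card ≤ ((coneTops σ u v F).erase P₀).card :=
        Finset.card_le_card_of_injOn Φ (fun t ht => Finset.mem_erase.mpr ⟨hP₀ne t ht, hΦmem t ht⟩) hinj
    _ = (coneTops σ u v F).card - 1 := Finset.card_erase_of_mem hP₀mem

/-! ### §3 The localised edge count -/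

/-- ★ PARTITION BY VERTICES: every chart value is exceptional for `u` (in `Xc σ u`) or has a unique top `v ∈ S1 u` of the normalised carrier
`u − u(0)`; hence for ANY `F`, `|Eset σ F| ≤ |Xc σ u| + Σ_{v ∈ S1 u} #{ties of F in the cone of v}`. [folklore] -/
theorem card_Eset_le_Xc_add_sum {σ : ℝ} (hσ : σ = 1 ∨ σ = -1) {u : Poly2} (hu : u - C (coeff 0 u) ≠ 0) (F : Poly2) :
    (Eset σ F).card ≤ (Xc σ u).card +
      ∑ v ∈ S1 u, ((Eset σ F).filter fun μ => μ ∉ Xc σ u ∧ IsUniqueTop (dir σ μ) (u - C (coeff 0 u)) v).card := by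
  have hsupp : (u - C (coeff 0 u)).support ⊆ S1 u := fun s hs => mem_S1.mpr (mem_support_sub_C_coeff_zero hs)
  have hsub : Eset σ F ⊆ Xc σ u ∪ (S1 u).biUnion
      (fun v => (Eset σ F).filter fun μ => μ ∉ Xc σ u ∧ IsUniqueTop (dir σ μ) (u - C (coeff 0 u)) v) := by
    intro μ hμ
    by_cases hX : μ ∈ Xc σ u
    · exact Finset.mem_union_left _ hX
    · have hν : ¬ IsEdgeDir (dir σ μ) (u - C (coeff 0 u)) := fun h =>
        hX (toricW_Eset_subset_Xc_of_support hσ hsupp ((mem_Eset hσ).mpr h))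
      obtain ⟨v, hv⟩ := exists_isUniqueTop_of_not_isEdgeDir hu hν
      exact Finset.mem_union_right _ (Finset.mem_biUnion.mpr ⟨v, hsupp hv.1, Finset.mem_filter.mpr ⟨hμ, hX, hv⟩⟩)
  exact (Finset.card_le_card hsub).trans ((Finset.card_union_le _ _).trans (Nat.add_le_add_left Finset.card_biUnion_le _))

/-- ★★ **THE LOCALISED EDGE COUNT (val-idea-crit-8 g6, memo rev C (C1)):** for every polynomial `F` and every non-constant carrier `u`,
`|Eset σ F| ≤ |Xc σ u| + Σ_{v ∈ S1 u} (|coneTops σ u v F| − 1)` — the edge directions of `F` are exceptional for `u` or switches between consecutive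
tops of `F` inside the cone of one vertex of `Newt(u − u(0))`. -/
theorem card_Eset_le_localised {σ : ℝ} (hσ : σ = 1 ∨ σ = -1) {u : Poly2} (hu : u - C (coeff 0 u) ≠ 0) (F : Poly2) :
    (Eset σ F).card ≤ (Xc σ u).card + ∑ v ∈ S1 u, ((coneTops σ u v F).card - 1) :=
  (card_Eset_le_Xc_add_sum hσ hu F).trans
    (Nat.add_le_add_left (Finset.sum_le_sum fun v _ => card_ties_le_coneTops_sub_one hσ u v F) _)

/-! ### §4 The toric Wronskian: non-resonant vertices have a single cone top -/

/-- ★ at a vertex `v` where no two columns resonate, the cone tops of `W_{J(·,u)}(X^e)` reduce to the corner `Σ_i (e_i + i•v)` (✓ `toricW_isUniqueTop_corner`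
localised; `J(·,u) = J(·,u − u(0))`). -/
theorem coneTops_toricW_subset_corner (σ : ℝ) (u : Poly2) {K : ℕ} (e : Fin K → Expo) {v : Expo}
    (hgen : ∀ i j : Fin K, idet (e i) v = idet (e j) v → i = j) :
    coneTops σ u v (wronskian (⇑(jacDer u)) (fun i => monomial (e i) (1 : ℂ))) ⊆ {∑ i : Fin K, (e i + (i : ℕ) • v)} := by
  intro P hP
  obtain ⟨-, μ, -, hv, hPt⟩ := Finset.mem_filter.mp hP
  rw [← jacDer_sub_C u (coeff 0 u)] at hPt
  exact Finset.mem_singleton.mpr (hPt.unique (toricW_isUniqueTop_corner hv e hgen))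

/-- hence a non-resonant vertex contributes `|coneTops| − 1 = 0` to the localised count. [folklore] -/
theorem card_coneTops_toricW_sub_one_eq_zero (σ : ℝ) (u : Poly2) {K : ℕ} (e : Fin K → Expo) {v : Expo}
    (hgen : ∀ i j : Fin K, idet (e i) v = idet (e j) v → i = j) :
    (coneTops σ u v (wronskian (⇑(jacDer u)) (fun i => monomial (e i) (1 : ℂ)))).card - 1 = 0 := by
  have h := Finset.card_le_card (coneTops_toricW_subset_corner σ u e hgen)
  rw [Finset.card_singleton] at h
  omega

end TowerKernel

end Summit.ValiantsHypothesis.ValiantsHypothesis.Theorems.TwoProducts.RankTwoJacobian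

end
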